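import Summits.QuantumFields.BalabanUV.Beta.FixedPointIdentification

/-!
# `BalabanUV.Beta.FP.FixedPointIdentificationSummable` — road «FP» for binder row D1, PROPOSED RULING R-FP-47 door (ii) «GHOST-RG» (owner, gen 15):
# A STEP LAW WITH A VARIABLE DEFECT WHOSE PARTIAL SUMS STAY BOUNDED STILL IDENTIFIES THE VALUE — `g (m+1) = g m + g 1 + δ m`, `|Σ_{k<m} δ k| ≤ D`,
# `|g m − m·s| ≤ C` ⟹ `g 1 = s`: a SUMMABLE step defect is harmless for `hident`, a STATIONARY one is not (`value_eq_of_defected_step_law_bounded`)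

HONEST DEPENDENCY (page 1, mandatory): continuum YM on T⁴ ⇐ BetaPertH ∧ nine spine estimates (0/9 proved); BetaPertH ⇐ (D1) ∧ (D4) ∧ CAP+tail;
G-an2-4 gates asym, D1 and NE2/3/4.  HONEST FRAMING (cell contract, verbatim): «discharging `BetaPertH` makes Bałaban's UV stability UNCONDITIONAL —
a real constructive-QFT result; it is NOT the continuum limit and NOT the Clay problem.»  THIS MODULE is [our object] elementary real arithmetic over the
owner's `FixedPointIdentification` (gen 1: `eq_of_nat_mul_sub_bounded`); no `def`, no `def … : Prop`, nothing cited, 0 sorry; 0∕4 row-D1 binders; it is a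
DOOR (hypothesis shape), not a discharge: NOT SDF, NOT D1, NOT BetaPertH, NOT continuum, NOT Clay.  «not in print; our bookkeeping».

ABSOLUTE RULE (cell charter, verbatim): «No internally-minted statement may enter as a cited fact. Every hypothesis is either kernel-proved in this package or a
verbatim quotation of a PUBLISHED theorem with page reference. The manuscript(s) under audit are NOT citable for their own disputed steps — they are the thing
under adjudication; programme-internal (2001/route/tribunal) claims are never citable.»

WHY (E-FP-15-2 ∕ PROPOSED R-FP-47, journal l.34659).  For the covariant literal the gluon-only one-loop kernels do NOT obey the step law exactly: the defect is the
typed gauge rows' Faddeev–Popov step defect (`GhostAwareStepLawHessian` ✓, memo §13), expected non-zero per step (g14's toy).  `FixedPointIdentification` §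
«defected» shows that a STATIONARY defect `δ` shifts the identified value to `s − δ`.  THIS FILE is the other half of the dichotomy: if the per-step defects
`δ m` have BOUNDED PARTIAL SUMS (e.g. they decay geometrically because the ghost sector approaches its own fixed point), the identification `g 1 = s` SURVIVES —
door (ii) «GHOST-RG» of R-FP-47: (SDF) may be replaced by «Σ-bounded step defect», an ESTIMATE row, without touching the END's conclusion.

CONTENTS: `closed_form_of_variableDefect_step_law` (`g m = m·g 1 + Σ_{k<m, k≥1} δ k`), **`value_eq_of_summableDefect_step_law_bounded`**, the `stepBal` reading
**`value_eq_stepBal_of_summableDefect_step_law_bounded`**, and the END-facing form **`stepLaw_sum_bounded_of_summableDefect`** (`|f (Lc^m) − m·f Lc| ≤ D`).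
Provenance: road FP OWNER b2b-balaban-beta-d1-p3 gen 15 (prover-b2b-balaban-beta-d1-p3-g15-0), 2026-08-21; R-FP-47 door (ii).
-/

namespace Summit.QuantumFields.BalabanUV.Beta.FP.FixedPointIdentificationSummable

open Finset
open Literature.MathematicalPhysics.QuantumFieldTheory.Balaban1983to89
open B12Normalization (stepBal)
open Summit.QuantumFields.BalabanUV.Beta.FixedPointIdentification (eq_of_nat_mul_sub_bounded stepBal_natPow)

/-- [our object] VARIABLE-DEFECT STEP LAW ⇒ CLOSED FORM: `g (m+1) = g m + g 1 + δ m` for `m ≥ 1` gives `g m = m·g 1 + Σ_{k ∈ [1, m)} δ k` for `m ≥ 1`. -/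
theorem closed_form_of_variableDefect_step_law {g δ : ℕ → ℝ} (hstep : ∀ m : ℕ, 1 ≤ m → g (m + 1) = g m + g 1 + δ m) :
    ∀ m : ℕ, 1 ≤ m → g m = (m : ℝ) * g 1 + ∑ k ∈ Finset.Ico 1 m, δ k := by
  intro m hm
  induction m with
  | zero => exact absurd hm (by norm_num)
  | succ n ih =>
    rcases Nat.eq_zero_or_pos n with h0 | hpos
    · subst h0; simp
    · rw [hstep n hpos, ih hpos, Finset.sum_Ico_succ_top hpos]
      push_cast; ring

/-- [our object] **A STEP LAW WITH Σ-BOUNDED DEFECTS STILL IDENTIFIES THE VALUE**: `g (m+1) = g m + g 1 + δ m`, `|Σ_{k ∈ [1,m)} δ k| ≤ D` and `|g m − m·s| ≤ C` for all `m ≥ 1`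
give `g 1 = s`.  (Contrast `FixedPointIdentification.value_eq_of_defected_step_law_bounded`: a CONSTANT defect `δ` gives `g 1 = s − δ`.) -/
theorem value_eq_of_summableDefect_step_law_bounded {g δ : ℕ → ℝ} {s C D : ℝ}
    (hstep : ∀ m : ℕ, 1 ≤ m → g (m + 1) = g m + g 1 + δ m) (hsum : ∀ m : ℕ, 1 ≤ m → |∑ k ∈ Finset.Ico 1 m, δ k| ≤ D)
    (hasym : ∀ m : ℕ, 1 ≤ m → |g m - (m : ℝ) * s| ≤ C) : g 1 = s := by
  have hcl := closed_form_of_variableDefect_step_law hstep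
  refine eq_of_nat_mul_sub_bounded (C := max (C + D) 0) fun m => ?_
  rcases Nat.eq_zero_or_pos m with h0 | hpos
  · subst h0; simp
  · have h1 := hasym m hpos
    have h2 := hsum m hpos
    rw [hcl m hpos] at h1
    have e : (m : ℝ) * (g 1 - s) = ((m : ℝ) * g 1 + ∑ k ∈ Finset.Ico 1 m, δ k - (m : ℝ) * s) - ∑ k ∈ Finset.Ico 1 m, δ k := by ring
    rw [e]
    exact ((abs_sub _ _).trans (by linarith [h1, h2])).trans (le_max_left _ _)

/-- [our object] The `stepBal` reading: for `f : ℕ → ℝ` indexed by blocking factors, `f (Lc^(m+1)) = f (Lc^m) + f Lc + δ m`, Σ-bounded `δ`, and the bounded-log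
asymptotics `|f (Lc^m) − stepBal N (Lc^m)| ≤ C` give `f Lc = stepBal N Lc` — `hident` with a SUMMABLE step defect. -/
theorem value_eq_stepBal_of_summableDefect_step_law_bounded {f : ℕ → ℝ} {δ : ℕ → ℝ} {Lc : ℕ} {N C D : ℝ}
    (hstep : ∀ m : ℕ, 1 ≤ m → f (Lc ^ (m + 1)) = f (Lc ^ m) + f Lc + δ m)
    (hsum : ∀ m : ℕ, 1 ≤ m → |∑ k ∈ Finset.Ico 1 m, δ k| ≤ D)
    (hasym : ∀ m : ℕ, 1 ≤ m → |f (Lc ^ m) - stepBal N ((Lc : ℝ) ^ m)| ≤ C) : f Lc = stepBal N Lc := by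
  have hstep' : ∀ m : ℕ, 1 ≤ m → (fun m => f (Lc ^ m)) (m + 1) = (fun m => f (Lc ^ m)) m + (fun m => f (Lc ^ m)) 1 + δ m := by
    intro m hm
    simp only [pow_one]
    exact hstep m hm
  have hasym' : ∀ m : ℕ, 1 ≤ m → |(fun m => f (Lc ^ m)) m - (m : ℝ) * stepBal N Lc| ≤ C := by
    intro m hm
    simp only
    rw [← stepBal_natPow]
    exact hasym m hm
  have h := value_eq_of_summableDefect_step_law_bounded (g := fun m => f (Lc ^ m)) hstep' hsum hasym'
  simpa only [pow_one] using h

/-- [our object] **THE END-FACING FORM**: a variable-defect step law with Σ-bounded defects gives the BOUNDED DEVIATION FROM THE PURE POWER LAW `|f (Lc^m) − m·f Lc| ≤ D`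
for every `m ≥ 1` — the shape a successor END can consume in place of the exact (STEP) binder. -/
theorem stepLaw_sum_bounded_of_summableDefect {f : ℕ → ℝ} {δ : ℕ → ℝ} {Lc : ℕ} {D : ℝ}
    (hstep : ∀ m : ℕ, 1 ≤ m → f (Lc ^ (m + 1)) = f (Lc ^ m) + f Lc + δ m)
    (hsum : ∀ m : ℕ, 1 ≤ m → |∑ k ∈ Finset.Ico 1 m, δ k| ≤ D) (m : ℕ) (hm : 1 ≤ m) :
    |f (Lc ^ m) - (m : ℝ) * f Lc| ≤ D := by
  have hstep' : ∀ m : ℕ, 1 ≤ m → (fun m => f (Lc ^ m)) (m + 1) = (fun m => f (Lc ^ m)) m + (fun m => f (Lc ^ m)) 1 + δ m := by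
    intro m hm
    simp only [pow_one]
    exact hstep m hm
  have hcl := closed_form_of_variableDefect_step_law (g := fun m => f (Lc ^ m)) hstep' m hm
  simp only [pow_one] at hcl
  rw [hcl]
  have e : (m : ℝ) * f Lc + ∑ k ∈ Finset.Ico 1 m, δ k - (m : ℝ) * f Lc = ∑ k ∈ Finset.Ico 1 m, δ k := by ring
  rw [e]
  exact hsum m hm

end Summit.QuantumFields.BalabanUV.Beta.FP.FixedPointIdentificationSummable

/-! ## §2 (v1.1, APPEND-ONLY) The bounded-deviation door composed with road A2's rate: the route theorem with a SUMMABLE step defect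
(R-FP-47 door (ii) «GHOST-RG» — the first link of the END v2′ chain; `FixedPointIdentification.oneLoopDrift_stepBal_of_rate_step_law_bounded` with (STEP)
weakened to `|f (Lc^m) − m·f Lc| ≤ D`). -/

namespace Summit.QuantumFields.BalabanUV.Beta.FP.FixedPointIdentificationSummable

open Finset
open Literature.MathematicalPhysics.QuantumFieldTheory.Balaban1983to89
open Literature.MathematicalPhysics.QuantumFieldTheory.Balaban1983to89.Beta.RateCertificate (GeomRate)
open Literature.MathematicalPhysics.QuantumFieldTheory.Balaban1983to89.Beta.Drift (OneLoopDrift)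
open B12Normalization (stepBal)
open Summit.QuantumFields.BalabanUV.Beta.FixedPointIdentification (eq_of_nat_mul_sub_bounded stepBal_natPow oneLoopDrift_of_geomRate_eq)

/-- [our object] **BOUNDED DEVIATION FROM THE POWER LAW + BOUNDED LOG DEFECT ⇒ EXACT VALUE**: `|f (Lc^m) − m·f Lc| ≤ D` and `|f (Lc^m) − m·v| ≤ C` for `m ≥ 1` give `f Lc = v`. -/
theorem value_eq_of_powdev_bounded {f : ℕ → ℝ} {Lc : ℕ} {v C D : ℝ}
    (hdev : ∀ m : ℕ, 1 ≤ m → |f (Lc ^ m) - (m : ℝ) * f Lc| ≤ D) (hasym : ∀ m : ℕ, 1 ≤ m → |f (Lc ^ m) - (m : ℝ) * v| ≤ C) : f Lc = v := by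
  refine eq_of_nat_mul_sub_bounded (C := max (C + D) 0) fun m => ?_
  rcases Nat.eq_zero_or_pos m with h0 | hpos
  · subst h0; simp
  · have h1 := hasym m hpos
    have h2 := hdev m hpos
    have e : (m : ℝ) * (f Lc - v) = (f (Lc ^ m) - (m : ℝ) * v) - (f (Lc ^ m) - (m : ℝ) * f Lc) := by ring
    rw [e]
    exact ((abs_sub _ _).trans (by linarith [h1, h2])).trans (le_max_left _ _)

/-- [our object] The `stepBal` reading: `|f (Lc^m) − m·f Lc| ≤ D` and `|f (Lc^m) − stepBal N (Lc^m)| ≤ C` give `f Lc = stepBal N Lc`. -/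
theorem value_eq_stepBal_of_powdev_bounded {f : ℕ → ℝ} {Lc : ℕ} {N C D : ℝ}
    (hdev : ∀ m : ℕ, 1 ≤ m → |f (Lc ^ m) - (m : ℝ) * f Lc| ≤ D) (hasym : ∀ m : ℕ, 1 ≤ m → |f (Lc ^ m) - stepBal N ((Lc : ℝ) ^ m)| ≤ C) :
    f Lc = stepBal N Lc :=
  value_eq_of_powdev_bounded hdev fun m hm => by rw [← stepBal_natPow]; exact hasym m hm

/-- [our object] **ROAD «FP», COMPOSED, BOUNDED-DEVIATION FORM**: geometric rate of the actual coefficients `β0 j` to `f Lc` [(CONV-C) ⇒ road A2] ∧ bounded deviation of `f` from the power law on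
the powers of `Lc` [a Σ-bounded step defect] ∧ bounded-log asymptotics `|f (Lc^m) − stepBal N (Lc^m)| ≤ C` ⟹ `OneLoopDrift (stepBal N Lc) (c₀/(1−θ)) β0`.  Hypotheses only; discharges nothing. -/
theorem oneLoopDrift_stepBal_of_rate_powdev_bounded {β0 : ℕ → ℝ} {f : ℕ → ℝ} {Lc : ℕ} {N c₀ θ C D : ℝ}
    (hrate : GeomRate β0 (f Lc) c₀ θ) (hθ0 : 0 ≤ θ) (hθ1 : θ < 1)
    (hdev : ∀ m : ℕ, 1 ≤ m → |f (Lc ^ m) - (m : ℝ) * f Lc| ≤ D)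
    (hasym : ∀ m : ℕ, 1 ≤ m → |f (Lc ^ m) - stepBal N ((Lc : ℝ) ^ m)| ≤ C) :
    OneLoopDrift (stepBal N Lc) (c₀ / (1 - θ)) β0 :=
  oneLoopDrift_of_geomRate_eq hrate hθ0 hθ1 (value_eq_stepBal_of_powdev_bounded hdev hasym)

/-- [our object] **ROAD «FP», COMPOSED, SUMMABLE-DEFECT FORM**: the same with the deviation supplied by a variable-defect step law whose defects have bounded partial sums
(`stepLaw_sum_bounded_of_summableDefect`). -/
theorem oneLoopDrift_stepBal_of_rate_summableDefect_bounded {β0 : ℕ → ℝ} {f : ℕ → ℝ} {δ : ℕ → ℝ} {Lc : ℕ} {N c₀ θ C D : ℝ}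
    (hrate : GeomRate β0 (f Lc) c₀ θ) (hθ0 : 0 ≤ θ) (hθ1 : θ < 1)
    (hstep : ∀ m : ℕ, 1 ≤ m → f (Lc ^ (m + 1)) = f (Lc ^ m) + f Lc + δ m)
    (hsum : ∀ m : ℕ, 1 ≤ m → |∑ k ∈ Finset.Ico 1 m, δ k| ≤ D)
    (hasym : ∀ m : ℕ, 1 ≤ m → |f (Lc ^ m) - stepBal N ((Lc : ℝ) ^ m)| ≤ C) :
    OneLoopDrift (stepBal N Lc) (c₀ / (1 - θ)) β0 :=
  oneLoopDrift_stepBal_of_rate_powdev_bounded hrate hθ0 hθ1 (stepLaw_sum_bounded_of_summableDefect hstep hsum) hasym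

end Summit.QuantumFields.BalabanUV.Beta.FP.FixedPointIdentificationSummable
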